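import Summits.AtomisticToContinuum.HydrodynamicLimit.Theorems.OneFlightGossipEngineCollisionActivityTailsAbnormalActivityTaggedKinetic
import HarnessLib

/-!
# `CollisionActivityTails` (stmt-AtomisticToContinuum-13734), line `plaque-thinning-count-ld`, stub 5, TAGGED half — file 4/6:
the scale arithmetic and the per-scale bounds in closed form

Helper file (`--supports stmt-AtomisticToContinuum-13734`) of the crux
`Summit.AtomisticToContinuum.HydrodynamicLimit.Theses.OneFlightGossipEngine.CollisionActivityTails`, line `plaque-thinning-count-ld`,
stub 5 (abnormal activity), TAGGED half `stub_taggedFromLabelEnvelope : LabelEnvelopeFromEnvelope → TaggedFromEnvelope`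
(file `…AbnormalActivityTagged`): under the true local Gibbs law the tagged cold window activity (collisions of particles sitting in an
over-dense or over-heated ball at some scale `≥ K`) is small in mean, from a label-set law envelope of the laws at the times of the
window. Vocabulary: `Tagged`, `tagAct`, `TaggedSmallOn`, `TaggedFromEnvelope`, `imp_le_relSpeed` of `…AbnormalActivity(Hot)` (w-abnormal),
`LabelLawEnvelope`, `LabelEnvelopeOn`, `LabelEnvelopeFromEnvelope` of `…EnvelopePlumbing` (lead), `windowEvent`, `pairTubeSet` of
`…AbnormalActivityStatics`.

This file: §6 the scale radii (`(4π/3)R_{K'}³ = K'/(N+1)`, enlarged ball `(4π/3)(R_{K'}+δ)³ ≤ 8K'/(N+1)` for `δ ≤ R_{K'}`) and the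
geometric decay of the per-scale constants (`count_decay`: `(8AK')^{m'}/m'! ≤ 4·2^{-K'}` for `y ≥ 100A`, `m'+2 = ⌈yK'⌉`;
`kinetic_decay`: `e^{-βyK'/4} e^{32AK'} ≤ 2^{-K'}` for `y ≥ 200A/β`); §7 the count and kinetic tags at scale `K'` in CLOSED FORM,
`≤ 4·2^{-K'} C² 4ε²h J` and `≤ 2^{-K'} C² 4ε²h J`, under `A = C(2π/β)^{3/2} ≥ 1` and the threshold `y ≥ 100 A`, resp. `y ≥ 200 A/β`
(`lintegral_tubePair_countScale_le`, `lintegral_tubePair_kineticScale_le`; registered helper sub-goal `stub_taggedKineticScale`).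

References: C. Cercignani, R. Illner, M. Pulvirenti, *The Mathematical Theory of Dilute Gases* (1994), §4.3, App. 4.A (collision
cylinders, collision sums along the hard-sphere flow); I. Gallagher, L. Saint-Raymond, B. Texier, *From Newton to Boltzmann* (2013),
Ch. 4. Elementary measure theory and bookkeeping; recorded here.
-/

noncomputable section

open MeasureTheory Set Filter Topology
open scoped ENNReal

namespace Summit.AtomisticToContinuum.HydrodynamicLimit.Theorems.CollisionActivityTailsAbnormalActivityTagged

open Literature.MathematicalPhysics.KineticTheory Literature.Analysis.FluidPDE
open Summit.AtomisticToContinuum.HydrodynamicLimit.Theorems.CollisionActivityTailsActivityDomination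
  (Flow Cfg window act tdist nearCount collisionPairSum_nonneg window_pos)
open Summit.AtomisticToContinuum.HydrodynamicLimit.Theorems.CollisionActivityTailsAbnormalActivityStatics
open Summit.AtomisticToContinuum.HydrodynamicLimit.Theorems.CollisionActivityTailsCrowdedActivityMeasurable
  (measurable_tdist_config natCast_nearCount)
open Summit.AtomisticToContinuum.HydrodynamicLimit.Theorems.CollisionActivityTailsEndpointTails (ae_mem_good_localGibbsLaw)
-- the tagging vocabulary and the two statements of the tagged half (w-abnormal's reduction file, landed):
open Summit.AtomisticToContinuum.HydrodynamicLimit.Theorems.CollisionActivityTailsAbnormalActivity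
  (rec imp relSpeed scaleRadius ballKinetic Tagged tagAct TaggedSmallOn TaggedFromEnvelope imp_le_relSpeed
    hsDiameter_sq_mul_window eventually_window_lt)
-- σ-finiteness of the phase spaces (named instances, landed):
open Summit.AtomisticToContinuum.HydrodynamicLimit.Theorems.MacroBookkeeping (sigmaFinite_volume_phase sigmaFinite_volume_config)
-- the label-set envelope vocabulary (the lead's plumbing, landed with `stub_labelEnvelopeOn`):
open Summit.AtomisticToContinuum.HydrodynamicLimit.Theorems.CollisionActivityTailsEnvelopePlumbing
  (gaussTupleWeight LabelLawEnvelope LabelEnvelopeOn LabelEnvelopeFromEnvelope)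

/-! ## §6 The scales: radii, volumes and the geometric decay of the per-scale bounds -/

section Scales

variable {N : ℕ}

/-- The cube of the scale radius: `(4π/3) R_{K'}³ = K'/(N+1)`. -/
theorem scaleRadius_cube (N K' : ℕ) : Real.pi * 4 / 3 * scaleRadius N K' ^ 3 = (K' : ℝ) / ((N : ℝ) + 1) := by
  unfold scaleRadius
  have hx : 0 ≤ 3 * (K' : ℝ) / (4 * Real.pi * ((N : ℝ) + 1)) := by positivity
  rw [show (1 / 3 : ℝ) = ((3 : ℕ) : ℝ)⁻¹ by norm_num, Real.rpow_inv_natCast_pow hx (by norm_num)]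
  field_simp

/-- The scale radius is positive at positive scales. -/
theorem scaleRadius_pos (N : ℕ) {K' : ℕ} (hK' : 1 ≤ K') : 0 < scaleRadius N K' := by
  unfold scaleRadius
  exact Real.rpow_pos_of_pos (by positivity) _

/-- The scale radius is nonnegative. -/
theorem scaleRadius_nonneg (N K' : ℕ) : 0 ≤ scaleRadius N K' := by
  unfold scaleRadius; exact Real.rpow_nonneg (by positivity) _

/-- The scale radius is monotone in the scale. -/
theorem scaleRadius_mono (N : ℕ) {K₁ K₂ : ℕ} (h : K₁ ≤ K₂) : scaleRadius N K₁ ≤ scaleRadius N K₂ := by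
  unfold scaleRadius
  refine Real.rpow_le_rpow (by positivity) ?_ (by norm_num)
  gcongr

/-- **Volume of the enlarged ball**: for an enlargement `0 ≤ δ ≤ R_{K'}`, `(4π/3)(R_{K'} + δ)³ ≤ 8 K'/(N+1)`. -/
theorem ballVol_enlarged_le (N K' : ℕ) {δ : ℝ} (hδ : 0 ≤ δ) (hδR : δ ≤ scaleRadius N K') :
    ballVol (scaleRadius N K' + δ) ≤ ENNReal.ofReal (8 * (K' : ℝ) / ((N : ℝ) + 1)) := by
  have hR := scaleRadius_nonneg N K'
  unfold ballVol
  rw [← ENNReal.ofReal_pow (by positivity), ← ENNReal.ofReal_mul (by positivity)]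
  refine ENNReal.ofReal_le_ofReal ?_
  calc (scaleRadius N K' + δ) ^ 3 * (Real.pi * 4 / 3) ≤ (2 * scaleRadius N K') ^ 3 * (Real.pi * 4 / 3) := by
        gcongr; linarith
    _ = 8 * (Real.pi * 4 / 3 * scaleRadius N K' ^ 3) := by ring
    _ = 8 * (K' : ℝ) / ((N : ℝ) + 1) := by rw [scaleRadius_cube]; ring

/-- `(4π/β)^{3/2} ≤ 4 (2π/β)^{3/2}` (`2^{3/2} ≤ 2² = 4`). -/
theorem gaussConst_half_le {β : ℝ} (hβ : 0 < β) :
    (2 * Real.pi / (β / 2)) ^ (3 / 2 : ℝ) ≤ 4 * (2 * Real.pi / β) ^ (3 / 2 : ℝ) := by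
  have h2 : (2 : ℝ) ^ (3 / 2 : ℝ) ≤ 4 := by
    calc (2 : ℝ) ^ (3 / 2 : ℝ) ≤ 2 ^ (2 : ℝ) := Real.rpow_le_rpow_of_exponent_le (by norm_num) (by norm_num)
      _ = 4 := by norm_num
  have hb : 0 ≤ 2 * Real.pi / β := by positivity
  calc (2 * Real.pi / (β / 2)) ^ (3 / 2 : ℝ) = (2 * (2 * Real.pi / β)) ^ (3 / 2 : ℝ) := by congr 1; field_simp
    _ = 2 ^ (3 / 2 : ℝ) * (2 * Real.pi / β) ^ (3 / 2 : ℝ) := Real.mul_rpow (by norm_num) hb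
    _ ≤ 4 * (2 * Real.pi / β) ^ (3 / 2 : ℝ) := by gcongr

/-- `2⁻¹ ^ n = e^{-n log 2}`. -/
theorem inv_two_pow_eq_exp (n : ℕ) : (2⁻¹ : ℝ) ^ n = Real.exp (-(n * Real.log 2)) := by
  rw [← Real.exp_log (by norm_num : (0 : ℝ) < 2⁻¹), ← Real.exp_nat_mul, Real.log_inv]; ring_nf

/-- **Geometric decay of the count tag**: with `A ≥ 1`, `y ≥ 100 A`, `K' ≥ 1` and `m' + 2 = ⌈y K'⌉`,
`(8 A K')^{m'} / m'! ≤ 4 · 2^{-K'}` (`x^n/n! ≤ e^x` at `x = 16 A K'`, `2^{-m'} = 4 · 2^{-⌈yK'⌉} ≤ 4 e^{-yK' log 2}`, and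
`16 A ≤ y log 2 - log 2`). -/
theorem count_decay {A y : ℝ} (hA : 1 ≤ A) (hy : 100 * A ≤ y) {K' : ℕ} (hK' : 1 ≤ K') {m' : ℕ} (hm : m' + 2 = ⌈y * K'⌉₊) :
    (8 * A * K') ^ m' / (m'.factorial : ℝ) ≤ 4 * 2⁻¹ ^ K' := by
  have hl2 := Real.log_two_gt_d9
  have hl2' := Real.log_two_lt_d9
  have hK'1 : (1 : ℝ) ≤ K' := by exact_mod_cast hK'
  have hx : 0 ≤ 16 * A * K' := by positivity
  have h1 : (8 * A * K') ^ m' / (m'.factorial : ℝ) = (16 * A * K') ^ m' / (m'.factorial : ℝ) * 2⁻¹ ^ m' := by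
    rw [show (8 : ℝ) * A * K' = 16 * A * K' * 2⁻¹ by ring, mul_pow]; ring
  have h2 : (2⁻¹ : ℝ) ^ m' = 4 * 2⁻¹ ^ (m' + 2) := by rw [pow_add]; ring
  have hceil : y * K' ≤ (⌈y * K'⌉₊ : ℝ) := Nat.le_ceil _
  have h3 : (2⁻¹ : ℝ) ^ (m' + 2) ≤ Real.exp (-(y * K' * Real.log 2)) := by
    rw [inv_two_pow_eq_exp, hm]
    exact Real.exp_le_exp.2 (by nlinarith)
  rw [h1, h2]
  calc (16 * A * K') ^ m' / (m'.factorial : ℝ) * (4 * 2⁻¹ ^ (m' + 2))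
      ≤ Real.exp (16 * A * K') * (4 * Real.exp (-(y * K' * Real.log 2))) := by
        gcongr
        exact Real.pow_div_factorial_le_exp _ hx _
    _ = 4 * Real.exp (16 * A * K' + -(y * K' * Real.log 2)) := by rw [Real.exp_add]; ring
    _ ≤ 4 * Real.exp (-(K' * Real.log 2)) := by
        gcongr
        have : (16 * A + Real.log 2) * K' ≤ y * Real.log 2 * K' := by
          apply mul_le_mul_of_nonneg_right _ (by positivity)
          nlinarith
        nlinarith
    _ = 4 * 2⁻¹ ^ K' := by rw [inv_two_pow_eq_exp]

/-- **Geometric decay of the kinetic tag**: with `A ≥ 1`, `β > 0`, `y ≥ 200 A / β`, `K' ≥ 1`: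
`e^{-(β/4) y K'} e^{32 A K'} ≤ 2^{-K'}`. -/
theorem kinetic_decay {A y β : ℝ} (hA : 1 ≤ A) (hβ : 0 < β) (hy : 200 * A * β⁻¹ ≤ y) {K' : ℕ} (hK' : 1 ≤ K') :
    Real.exp (-(β / 4 * (y * K'))) * Real.exp (32 * A * K') ≤ 2⁻¹ ^ K' := by
  have hl2' := Real.log_two_lt_d9
  have hK'1 : (1 : ℝ) ≤ K' := by exact_mod_cast hK'
  have hyβ : 50 * A ≤ β / 4 * y := by
    have h := mul_le_mul_of_nonneg_left hy (by positivity : 0 ≤ β / 4)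
    calc 50 * A = β / 4 * (200 * A * β⁻¹) := by field_simp; ring
      _ ≤ β / 4 * y := h
  rw [← Real.exp_add, inv_two_pow_eq_exp]
  refine Real.exp_le_exp.2 ?_
  have : (32 * A + Real.log 2) * K' ≤ β / 4 * y * K' := by
    apply mul_le_mul_of_nonneg_right _ (by positivity)
    nlinarith
  nlinarith

end Scales

/-! ## §7 The per-scale bounds in closed form and their sum over the scales -/

section ScaleSum

variable {N : ℕ}

/-- The count event in the real form of `Tagged` is the event `⌈yK'⌉ ≤ #`, i.e. `m' + 2 ≤ #` with `m' = ⌈yK'⌉ - 2` (`yK' ≥ 2`). -/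
theorem countEvent_iff {y : ℝ} {K' : ℕ} (hyK : 2 ≤ y * K') (n : ℕ) :
    y * K' ≤ (n : ℝ) ↔ (⌈y * K'⌉₊ - 2) + 2 ≤ n := by
  have h2 : 2 ≤ ⌈y * K'⌉₊ := by
    have : (2 : ℝ) ≤ ⌈y * K'⌉₊ := hyK.trans (Nat.le_ceil _)
    exact_mod_cast this
  rw [Nat.sub_add_cancel h2, Nat.ceil_le]

/-- **THE COUNT TAG AT SCALE `K'`, closed form**: under the threshold `y ≥ 100 A`, `A = C (2π/β)^{3/2} ≥ 1`, with the enlarged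
radius `R_{K'} + δ`, `0 ≤ δ ≤ R_{K'}`: `∫ tubePair 𝟙{y K' ≤ #} dμ ≤ 4 · 2^{-K'} · C² · 4ε²h J`. -/
theorem lintegral_tubePair_countScale_le {μ : Measure (Cfg N)} {C β : ℝ} (hC : 0 ≤ C) (hβ : 0 < β)
    (hμ : LabelLawEnvelope μ C β) {k l : Fin (N + 1)} (hkl : k ≠ l) {S : V3 → Set V3}
    (hSm : MeasurableSet {q : V3 × V3 | q.1 ∈ S q.2}) {ε h : ℝ} (hεh : 0 ≤ 4 * ε ^ 2 * h)
    (hSvol : ∀ u, volume (S u) ≤ ENNReal.ofReal (4 * ε ^ 2 * h * ‖u‖))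
    (hA : 1 ≤ C * (2 * Real.pi / β) ^ (3 / 2 : ℝ)) {y : ℝ} (hy : 100 * (C * (2 * Real.pi / β) ^ (3 / 2 : ℝ)) ≤ y)
    {K' : ℕ} (hK' : 1 ≤ K') {δ : ℝ} (hδ : 0 ≤ δ) (hδR : δ ≤ scaleRadius N K') :
    ∫⁻ w, tubePair S (w k) (w l) * (if y * K' ≤ (nearCount w k (scaleRadius N K' + δ) : ℝ) then 1 else 0) ∂μ ≤
      4 * 2⁻¹ ^ K' * (ENNReal.ofReal (C ^ 2) * (ENNReal.ofReal (4 * ε ^ 2 * h) * fluxJ β)) := by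
  set A : ℝ := C * (2 * Real.pi / β) ^ (3 / 2 : ℝ) with hAdef
  set cβ : ℝ := (2 * Real.pi / β) ^ (3 / 2 : ℝ) with hcβ
  have hcβ0 : 0 ≤ cβ := by positivity
  set R : ℝ := scaleRadius N K' + δ with hR
  set m' : ℕ := ⌈y * K'⌉₊ - 2 with hm'
  set P : ℝ≥0∞ := ENNReal.ofReal (4 * ε ^ 2 * h) * fluxJ β with hP
  have hK'1 : (1 : ℝ) ≤ K' := by exact_mod_cast hK'
  have hyK : 2 ≤ y * K' := by nlinarith
  have hm2 : m' + 2 = ⌈y * K'⌉₊ := by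
    have : (2 : ℝ) ≤ ⌈y * K'⌉₊ := hyK.trans (Nat.le_ceil _)
    have h2 : 2 ≤ ⌈y * K'⌉₊ := by exact_mod_cast this
    rw [hm']; omega
  -- rewrite the event and apply the one-scale count bound
  have hev : ∀ w : Cfg N, (if y * K' ≤ (nearCount w k R : ℝ) then (1 : ℝ≥0∞) else 0) =
      (if m' + 2 ≤ nearCount w k R then 1 else 0) := fun w => by simp only [countEvent_iff hyK]; rfl
  simp_rw [hev]
  refine (lintegral_tubePair_count_le hC hβ hμ hkl hSm hεh hSvol R m').trans ?_
  -- the constants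
  have hN1 : (0 : ℝ) < (N : ℝ) + 1 := by positivity
  have hvol : ballVol R ≤ ENNReal.ofReal (8 * (K' : ℝ) / ((N : ℝ) + 1)) := ballVol_enlarged_le N K' hδ hδR
  have hchoose : ((N - 1).choose m' : ℝ≥0∞) ≤ ENNReal.ofReal (((N : ℝ) + 1) ^ m' / m'.factorial) := by
    have h1 : (((N - 1).choose m' : ℕ) : ℝ) ≤ ((N - 1 : ℕ) : ℝ) ^ m' / m'.factorial := Nat.choose_le_pow_div m' (N - 1)
    have h2 : ((N - 1 : ℕ) : ℝ) ≤ (N : ℝ) + 1 := by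
      have : ((N - 1 : ℕ) : ℝ) ≤ N := by exact_mod_cast Nat.sub_le N 1
      linarith
    have h3 : (((N - 1).choose m' : ℕ) : ℝ) ≤ ((N : ℝ) + 1) ^ m' / m'.factorial :=
      h1.trans (by gcongr)
    calc ((N - 1).choose m' : ℝ≥0∞) = ENNReal.ofReal (((N - 1).choose m' : ℕ) : ℝ) := by rw [ENNReal.ofReal_natCast]
      _ ≤ _ := ENNReal.ofReal_le_ofReal h3
  have hfac : (ENNReal.ofReal C * (ballVol R * ENNReal.ofReal cβ)) ^ m' ≤
      ENNReal.ofReal ((C * (8 * (K' : ℝ) / ((N : ℝ) + 1)) * cβ) ^ m') := by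
    rw [ENNReal.ofReal_pow (by positivity)]
    gcongr
    calc ENNReal.ofReal C * (ballVol R * ENNReal.ofReal cβ)
        ≤ ENNReal.ofReal C * (ENNReal.ofReal (8 * (K' : ℝ) / ((N : ℝ) + 1)) * ENNReal.ofReal cβ) := by gcongr
      _ = _ := by rw [ENNReal.ofReal_mul (by positivity), ENNReal.ofReal_mul hC]; ring
  have hreal : ((N : ℝ) + 1) ^ m' / m'.factorial * ((C * (8 * (K' : ℝ) / ((N : ℝ) + 1))) * cβ) ^ m' ≤ 4 * 2⁻¹ ^ K' := by
    have : ((N : ℝ) + 1) ^ m' / m'.factorial * ((C * (8 * (K' : ℝ) / ((N : ℝ) + 1))) * cβ) ^ m' =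
        (8 * A * K') ^ m' / m'.factorial := by
      rw [hAdef, div_mul_eq_mul_div, ← mul_pow]
      congr 2
      field_simp
    rw [this]
    exact count_decay hA hy hK' hm2
  calc ((N - 1).choose m' : ℝ≥0∞) * (ENNReal.ofReal (C ^ 2) * (ENNReal.ofReal C * (ballVol R * ENNReal.ofReal cβ)) ^ m' * P)
      ≤ ENNReal.ofReal (((N : ℝ) + 1) ^ m' / m'.factorial) *
          (ENNReal.ofReal (C ^ 2) * ENNReal.ofReal ((C * (8 * (K' : ℝ) / ((N : ℝ) + 1)) * cβ) ^ m') * P) := by gcongr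
    _ = ENNReal.ofReal (((N : ℝ) + 1) ^ m' / m'.factorial * ((C * (8 * (K' : ℝ) / ((N : ℝ) + 1))) * cβ) ^ m') *
          (ENNReal.ofReal (C ^ 2) * P) := by rw [ENNReal.ofReal_mul (by positivity)]; ring
    _ ≤ ENNReal.ofReal (4 * 2⁻¹ ^ K') * (ENNReal.ofReal (C ^ 2) * P) := by gcongr
    _ = 4 * 2⁻¹ ^ K' * (ENNReal.ofReal (C ^ 2) * P) := by
        rw [ENNReal.ofReal_mul (by norm_num), ENNReal.ofReal_pow (by norm_num), ENNReal.ofReal_inv_of_pos (by norm_num)]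
        norm_num

/-- **THE KINETIC TAG AT SCALE `K'`, closed form**: under the threshold `y ≥ 200 A / β`, `A = C (2π/β)^{3/2} ≥ 1`, with the enlarged
radius `R_{K'} + δ`, `0 ≤ δ ≤ R_{K'}`: `∫ tubePair 𝟙{y K' ≤ Σ_j 𝟙_j |v_j|²} dμ ≤ 2^{-K'} · C² · 4ε²h J`. -/
theorem lintegral_tubePair_kineticScale_le {μ : Measure (Cfg N)} {C β : ℝ} (hC : 0 ≤ C) (hβ : 0 < β)
    (hμ : LabelLawEnvelope μ C β) {k l : Fin (N + 1)} (hkl : k ≠ l) {S : V3 → Set V3}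
    (hSm : MeasurableSet {q : V3 × V3 | q.1 ∈ S q.2}) {ε h : ℝ} (hεh : 0 ≤ 4 * ε ^ 2 * h)
    (hSvol : ∀ u, volume (S u) ≤ ENNReal.ofReal (4 * ε ^ 2 * h * ‖u‖))
    (hA : 1 ≤ C * (2 * Real.pi / β) ^ (3 / 2 : ℝ)) {y : ℝ} (hy : 200 * (C * (2 * Real.pi / β) ^ (3 / 2 : ℝ)) * β⁻¹ ≤ y)
    {K' : ℕ} (hK' : 1 ≤ K') {δ : ℝ} (hδ : 0 ≤ δ) (hδR : δ ≤ scaleRadius N K') :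
    ∫⁻ w, tubePair S (w k) (w l) * (if y * K' ≤ ballKinetic w k (scaleRadius N K' + δ) then 1 else 0) ∂μ ≤
      2⁻¹ ^ K' * (ENNReal.ofReal (C ^ 2) * (ENNReal.ofReal (4 * ε ^ 2 * h) * fluxJ β)) := by
  set A : ℝ := C * (2 * Real.pi / β) ^ (3 / 2 : ℝ) with hAdef
  set cβ : ℝ := (2 * Real.pi / β) ^ (3 / 2 : ℝ) with hcβ
  set c' : ℝ := (2 * Real.pi / (β / 2)) ^ (3 / 2 : ℝ) with hc'
  have hcβ0 : 0 ≤ cβ := by positivity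
  have hc'0 : 0 ≤ c' := by positivity
  have hc'le : c' ≤ 4 * cβ := gaussConst_half_le hβ
  set R : ℝ := scaleRadius N K' + δ with hR
  set P : ℝ≥0∞ := ENNReal.ofReal (4 * ε ^ 2 * h) * fluxJ β with hP
  have hK'1 : (1 : ℝ) ≤ K' := by exact_mod_cast hK'
  refine (lintegral_tubePair_kinetic_le hC hβ hμ hkl hSm hεh hSvol R (y * K')).trans ?_
  have hN1 : (0 : ℝ) < (N : ℝ) + 1 := by positivity
  have hvol : ballVol R ≤ ENNReal.ofReal (8 * (K' : ℝ) / ((N : ℝ) + 1)) := ballVol_enlarged_le N K' hδ hδR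
  -- the binomial factor
  set x : ℝ := C * (8 * (K' : ℝ) / ((N : ℝ) + 1)) * c' with hx
  have hx0 : 0 ≤ x := by positivity
  have hbase : ENNReal.ofReal C * (ballVol R * ENNReal.ofReal c') + 1 ≤ ENNReal.ofReal (x + 1) := by
    calc ENNReal.ofReal C * (ballVol R * ENNReal.ofReal c') + 1
        ≤ ENNReal.ofReal C * (ENNReal.ofReal (8 * (K' : ℝ) / ((N : ℝ) + 1)) * ENNReal.ofReal c') + 1 := by gcongr
      _ = ENNReal.ofReal (x + 1) := by
          rw [ENNReal.ofReal_add hx0 zero_le_one, ENNReal.ofReal_one, hx, ENNReal.ofReal_mul (by positivity),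
            ENNReal.ofReal_mul hC]
          ring
  have hpow : (ENNReal.ofReal C * (ballVol R * ENNReal.ofReal c') + 1) ^ (N - 1) ≤ ENNReal.ofReal (Real.exp (32 * A * K')) := by
    calc (ENNReal.ofReal C * (ballVol R * ENNReal.ofReal c') + 1) ^ (N - 1) ≤ ENNReal.ofReal (x + 1) ^ (N - 1) := by gcongr
      _ = ENNReal.ofReal ((x + 1) ^ (N - 1)) := (ENNReal.ofReal_pow (by positivity) _).symm
      _ ≤ ENNReal.ofReal (Real.exp (32 * A * K')) := ENNReal.ofReal_le_ofReal ?_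
    calc (x + 1) ^ (N - 1) ≤ Real.exp x ^ (N - 1) := by gcongr; exact Real.add_one_le_exp x
      _ = Real.exp ((N - 1 : ℕ) * x) := by rw [← Real.exp_nat_mul]
      _ ≤ Real.exp (32 * A * K') := Real.exp_le_exp.2 ?_
    have hN' : ((N - 1 : ℕ) : ℝ) ≤ (N : ℝ) + 1 := by
      have : ((N - 1 : ℕ) : ℝ) ≤ N := by exact_mod_cast Nat.sub_le N 1
      linarith
    calc ((N - 1 : ℕ) : ℝ) * x ≤ ((N : ℝ) + 1) * x := mul_le_mul_of_nonneg_right hN' hx0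
      _ = 8 * C * c' * K' := by rw [hx]; field_simp
      _ ≤ 8 * C * (4 * cβ) * K' := by gcongr
      _ = 32 * A * K' := by rw [hAdef]; ring
  calc ENNReal.ofReal (Real.exp (-(β / 4 * (y * K')))) *
        (ENNReal.ofReal (C ^ 2) * (ENNReal.ofReal C * (ballVol R * ENNReal.ofReal c') + 1) ^ (N - 1) * P)
      ≤ ENNReal.ofReal (Real.exp (-(β / 4 * (y * K')))) * (ENNReal.ofReal (C ^ 2) * ENNReal.ofReal (Real.exp (32 * A * K')) * P) := by
        gcongr
    _ = ENNReal.ofReal (Real.exp (-(β / 4 * (y * K'))) * Real.exp (32 * A * K')) * (ENNReal.ofReal (C ^ 2) * P) := by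
        rw [ENNReal.ofReal_mul (Real.exp_nonneg _)]; ring
    _ ≤ ENNReal.ofReal (2⁻¹ ^ K') * (ENNReal.ofReal (C ^ 2) * P) := by gcongr; exact kinetic_decay hA hβ hy hK'
    _ = 2⁻¹ ^ K' * (ENNReal.ofReal (C ^ 2) * P) := by
        rw [ENNReal.ofReal_pow (by norm_num), ENNReal.ofReal_inv_of_pos (by norm_num)]
        norm_num

/-- **Helper sub-goal `stub_taggedKineticScale`** (line `plaque-thinning-count-ld`, stub 5, tagged half, file 4): the kinetic tag
at scale `K'` in closed form under a label-set law envelope (`lintegral_tubePair_kineticScale_le`). -/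
theorem stub_taggedKineticScale : ∀ {N : ℕ} {μ : Measure (Cfg N)} {C β : ℝ}, 0 ≤ C → 0 < β → LabelLawEnvelope μ C β → ∀ {k l : Fin (N + 1)}, k ≠ l → ∀ {S : V3 → Set V3}, MeasurableSet {q : V3 × V3 | q.1 ∈ S q.2} → ∀ {ε h : ℝ}, 0 ≤ 4 * ε ^ 2 * h → (∀ u, volume (S u) ≤ ENNReal.ofReal (4 * ε ^ 2 * h * ‖u‖)) → 1 ≤ C * (2 * Real.pi / β) ^ (3 / 2 : ℝ) → ∀ {y : ℝ}, 200 * (C * (2 * Real.pi / β) ^ (3 / 2 : ℝ)) * β⁻¹ ≤ y → ∀ {K' : ℕ}, 1 ≤ K' → ∀ {δ : ℝ}, 0 ≤ δ → δ ≤ scaleRadius N K' → ∫⁻ w, tubePair S (w k) (w l) * (if y * K' ≤ ballKinetic w k (scaleRadius N K' + δ) then 1 else 0) ∂μ ≤ 2⁻¹ ^ K' * (ENNReal.ofReal (C ^ 2) * (ENNReal.ofReal (4 * ε ^ 2 * h) * fluxJ β)) :=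
  fun hC hβ hμ _ _ hkl _ hSm _ _ hεh hSvol hA _ hy _ hK' _ hδ hδR =>
    lintegral_tubePair_kineticScale_le hC hβ hμ hkl hSm hεh hSvol hA hy hK' hδ hδR

end ScaleSum

end Summit.AtomisticToContinuum.HydrodynamicLimit.Theorems.CollisionActivityTailsAbnormalActivityTagged

end
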